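import Mathlib
import Summits.PneNP.PneNP.Theses.OneSlice
import Summits.PneNP.PneNP.Theorems.OneSliceSliceTargetSplit
import Summits.PneNP.PneNP.Theorems.OneSliceMonotoneContinuationDefs
import Summits.PneNP.PneNP.Theorems.OneSliceMonotoneContinuationDerandomize

/-!
# Route OneSlice, crux `MonotoneContinuation` (stmt-PneNP-18471), line `Sketch_ideator1_r1` (ProfileLine) — stub derandomize_general

DERANDOMIZED MAJORITY VOTE UNDER AN ARBITRARY PROBABILITY VECTOR ON THE CUBE. Let `ν` be any probability vector
on the edge cube of `K_n` (in the line: the uniform law of a Hamming slice), `w` a probability vector on the cube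
("restrictions" `ρ`), `g ρ` Boolean tests with `w`-average `U(y) := Σ_ρ w(ρ)·𝟙[g ρ y]`, and `G` any Boolean
function. For every `t ≥ 1` some `t` FIXED restrictions `ρs : Fin t → cube` have majority vote
`majVote (fun a => g (ρs a))` within `4/t + 5·Σ_y ν(y)|U(y) − 𝟙[G y]|` of `U` in `L¹(ν)`.

This is the measure-agnostic form of `stub_derandomize` (`…OneSliceMonotoneContinuationDerandomize`, where
`ν = gnpWeight n p`), and the proof is the same probabilistic-method argument, REUSING that file's generic helpers:
draw `ρs ∼ w^{⊗t}` (product weight `Π_a w(ρs a)`, total mass `1` by `Fintype.sum_pow`); a minimiser of the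
`L¹(ν)` error is at most its `w^{⊗t}`-average (`derandomize_exists_le_avg`); after swapping the two finite sums
(`Finset.sum_comm`) the average is `Σ_y ν(y)·E_ρs|Maj_ρs(y) − U(y)|`, and for a FIXED `y` the inner expectation is
at most `3/t + 5|U(y) − 𝟙[G y]|` (`derandomize_point`: Chebyshev for the number of accepting votes among `t`
independent `w`-samples, trivial unless `U(y)` is within `1/5` of `𝟙[G y]`). Integrating against `ν` (total mass
`1`) gives `3/t + 5·Σ_y ν(y)|U(y) − 𝟙[G y]| ≤ 4/t + 5·Σ_y ν(y)|U(y) − 𝟙[G y]|`.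
-/

set_option linter.dupNamespace false -- `Summit.PneNP.PneNP.…`: summit = sub-problem (D-0017)

namespace Summit.PneNP.PneNP.Theorems.MonotoneContinuation

open Literature.Computability.Complexity hiding supp mem_supp
open Finset hiding slice
open Classical
open Summit.PneNP.PneNP.Theorems.ConstantBand.Negative (Edge slice)
open Summit.PneNP.PneNP.Theorems.SliceTargetSplit (ind)

noncomputable section

/-- **Derandomized majority under an arbitrary probability vector on the cube.** For probability vectors `ν`
(points `y`) and `w` (restrictions `ρ`) on the edge cube of `K_n`, Boolean tests `g ρ` with `w`-average
`U(y) = Σ_ρ w(ρ)·𝟙[g ρ y]`, any Boolean `G` and any `t ≥ 1`, some `t` FIXED restrictions `ρs : Fin t → cube` have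
majority vote `majVote (fun a => g (ρs a))` within `4/t + 5‖U − 𝟙[G]‖_{L¹(ν)}` of `U` in `L¹(ν)` (average over
`ρs ∼ w^{⊗t}`, swap the sums, the one-point Chebyshev bound `derandomize_point`, and `Σ_y ν y = 1`); the
measure-agnostic form of `stub_derandomize`. [folklore] -/
theorem derandomize_general :
  ∀ (n t : ℕ), 0 < t → ∀ (ν : (Edge n → Bool) → ℝ), (∀ y, 0 ≤ ν y) → ∑ y, ν y = 1 →
    ∀ (w : (Edge n → Bool) → ℝ), (∀ ρ, 0 ≤ w ρ) → ∑ ρ, w ρ = 1 →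
    ∀ (g : (Edge n → Bool) → (Edge n → Bool) → Bool) (G : (Edge n → Bool) → Bool),
      ∃ ρs : Fin t → Edge n → Bool,
        ∑ y, ν y * |ind (majVote fun a => g (ρs a)) y - ∑ ρ, w ρ * ind (g ρ) y| ≤
          4 / t + 5 * ∑ y, ν y * |(∑ ρ, w ρ * ind (g ρ) y) - ind G y| := by
  intro n t ht ν hν hν1 w hw hw1 g G
  -- averaging over `ρs ∼ w^{⊗t}`: a minimiser of the `L¹(ν)` error is at most the average error
  obtain ⟨ρs, hρs⟩ := derandomize_exists_le_avg (fun ρs : Fin t → Edge n → Bool => ∏ a, w (ρs a))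
    (fun ρs => ∑ y, ν y * |ind (majVote fun a => g (ρs a)) y - ∑ ρ, w ρ * ind (g ρ) y|)
    (fun ρs => prod_nonneg fun a _ => hw (ρs a)) (by rw [← Fintype.sum_pow, hw1, one_pow])
  refine ⟨ρs, hρs.trans ?_⟩
  -- the one-point bound, for every point `y` of the cube
  have hper : ∀ y : Edge n → Bool,
      ∑ ρs : Fin t → Edge n → Bool, (∏ a, w (ρs a)) *
          |ind (majVote fun a => g (ρs a)) y - ∑ ρ, w ρ * ind (g ρ) y| ≤
        3 / t + 5 * |(∑ ρ, w ρ * ind (g ρ) y) - ind G y| := by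
    intro y
    have hy := derandomize_point w hw hw1 (fun ρ => g ρ y) ht (G y)
    simp only [ind, majVote_def]
    convert hy using 6
  -- two bookkeeping identities against `ν` (total mass `1`)
  have h1 : ∑ y : Edge n → Bool, ν y * (3 / (t : ℝ)) = 3 / t := by
    rw [← sum_mul, hν1, one_mul]
  have h2 : ∑ y : Edge n → Bool, ν y * (5 * |(∑ ρ, w ρ * ind (g ρ) y) - ind G y|) =
      5 * ∑ y, ν y * |(∑ ρ, w ρ * ind (g ρ) y) - ind G y| := by
    rw [mul_sum]
    exact sum_congr rfl fun y _ => by ring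
  have h34 : (3 : ℝ) / t ≤ 4 / t := div_le_div_of_nonneg_right (by norm_num) (by exact_mod_cast ht.le)
  calc ∑ ρs : Fin t → Edge n → Bool, (∏ a, w (ρs a)) *
        ∑ y, ν y * |ind (majVote fun a => g (ρs a)) y - ∑ ρ, w ρ * ind (g ρ) y|
      = ∑ y, ν y * ∑ ρs : Fin t → Edge n → Bool, (∏ a, w (ρs a)) *
          |ind (majVote fun a => g (ρs a)) y - ∑ ρ, w ρ * ind (g ρ) y| := by
        simp only [mul_sum]
        rw [sum_comm]
        exact sum_congr rfl fun y _ => sum_congr rfl fun ρs _ => by ring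
    _ ≤ ∑ y, ν y * (3 / t + 5 * |(∑ ρ, w ρ * ind (g ρ) y) - ind G y|) :=
        sum_le_sum fun y _ => mul_le_mul_of_nonneg_left (hper y) (hν y)
    _ = 3 / t + 5 * ∑ y, ν y * |(∑ ρ, w ρ * ind (g ρ) y) - ind G y| := by
        simp only [mul_add, sum_add_distrib, h1, h2]
    _ ≤ 4 / t + 5 * ∑ y, ν y * |(∑ ρ, w ρ * ind (g ρ) y) - ind G y| := add_le_add h34 le_rfl

end

end Summit.PneNP.PneNP.Theorems.MonotoneContinuation
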